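import Summits.BirchSwinnertonDyer.Rank1Residual.X9.TransportSweepA
import HarnessLib

/-!
# Class X9, `p = 5`: the TRANSPORT SWEEP, part H — `BSD(E,5)` for 3 Tamagawa-obstructed `5S4` pairs (2 of analytic rank `0`, 1 of analytic rank `1`)
# by Greenberg–Vatsal transport from LEVEL-LOWERED (or prime-traded) congruent partners — per-pair kernel records, the partner's `BSD(A,5)` a displayed binder

HONEST FRAMING (cell `b2b-bsdres-*`, verbatim): the cell deletes COMBINATION-SHAPED residual classes of
the rank-≤1 BSD formula from PUBLISHED theorems only and TYPES the construction-shaped remainder; this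
is not "finishing BSD". Class X9 (good ordinary `p ≥ 5`, `ρ̄_{E,p}` irreducible and not surjective) stays
TYPED at class level; everything here is PER PAIR; no lane verdict is changed; no named fact is introduced;
nothing is booked by this unit (the lane books, the referee rules). Unit `b2b-bsdres-x9`, gen 16
(companion of `X9/TransportSweepA.lean`, whose §1 has the generic theorems and the full account).

## What this file does (our own work, hence `Summits/`)

As in part A: the
`p`-part of BSD PROPAGATES along mod-`p` congruences between curves of analytic rank `≤ 1` — C1 `A[p] ≅ E[p]` (finite by
Kraus–Oesterlé 1992 Prop. 4) + `BSD(A,p)` + C2 (a unit coefficient of `𝓛_MSD(A)`) + C3 (Schneider's certificate for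
whichever of `A`, `E` has analytic rank `1`) ⟹ Mazur's main conjecture for `(A,p)` with `μ = 0` (BCS 2025 Thm. 1.1.2 (a),
exponent forced to `0`) ⟹ the same for `(E,p)` (Greenberg–Vatsal 2000 Thm. (1.4)) ⟹ `BSD(E,p)` (rank `0`: Greenberg
Thm. 4.1 + interpolation + GZK; rank `1`: Perrin-Riou–Schneider + Perrin-Riou 1987 + GZK).


GEN 16's SWEEP (`HOME/b2b-bsdres-x9/X9-CENSUS-G16.md`, `g16/sweep/`):
after gen 15 exactly 66 X9 pairs (`N < 5·10⁵`, `r_an ≤ 1`; all `5S4`) had NO flag-free route — only the Jetchev–Cha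
index bound at a non-surjective prime (x9 fold `JETCHEV-CHA`; lane flag `JET@nonsurj` / `Miller11-Thm54-Cha-case`): one
multiplicative prime `ℓ` with `5 ∣ c_ℓ` inflates every Heegner index. At that prime `E[5]` is UNRAMIFIED (`5 ∣ v_ℓ(Δ)`),
so level lowering predicts a congruent newform of level `N_E/ℓ`; a screen of all `2 164 260` Cremona isogeny classes
(`cong_screen_g16.py`: conductor support + trace conditions at `ℓ ≤ 97`) finds a RATIONAL congruent partner below
`5·10⁵` for 32 of the 66 (29 level-lowered, `N_A ∣ N_E`; 3 congruent only to each other) and a USABLE one — analytic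
rank `≤ 1`, good ordinary at `5`, flag-free two-engine Heegner certificate (x9 fold CERT, `ord₅ [A(K):ℤy_K] = 0`) —
for 26 = the 4 T-JET cells of gen 15 + the 22 pairs of this sweep (parts A–H; 19 level-lowered, 3 with the extra
multiplicative prime traded `7 ↔ 3`). This part: `69312bg1 ← 23104d1`, `69312dm1 ← 23104bw1`, `88872n1 ← 4232d1`.
Certificates of THIS unit (kit j130867; gen-15 kit `jobT` byte copies + `make_input_g16.py`): C1 by TWO engines (PARI
`ellap`; ENGINE D pure-Python BSGS/Mestre, self-test PASS) up to the Kraus–Oesterlé bound — 22/22 OK, identical prime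
counts; C3 by TWO engines (PARI `ellpadicheight`; pure-Python Mazur–Tate σ engine) for every rank-`1` target and partner,
all finite; C2 = gen 9's two-engine `μ(𝓛₅) = 0` table `g9/mu/MU-ALL.tsv` (790/790 X9 pairs; every partner is an X9 pair).
In the kernel these stay BINDERS (`hcong`, `hcertA`, `hSchA`, `hC3`).

References: Greenberg–Vatsal, Invent. Math. 142 (2000) Thm. (1.4); Burungale–Castella–Skinner, IMRN 2025
Thm. 1.1.2 (a); Kraus–Oesterlé, Math. Ann. 293 (1992) Prop. 4; Greenberg, LNM 1716 (1999) Thm. 4.1;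
Perrin-Riou 1987 §1.4; Balakrishnan–Müller–Stein 2016 Thm. 1.7 (Schneider); Mazur 1978 Prop. 6.3 (1);
Ribet 1990 (level lowering; motivation only); Miller 2011 Thm. 1.2 / Def. 1.1; Silverman AEC VII.1; Cremona's tables.
-/

set_option autoImplicit false

noncomputable section

open scoped Classical MatrixGroups ModularForm

open CongruenceSubgroup WeierstrassCurve Literature.NumberTheory.EllipticCurves
  Literature.NumberTheory.EllipticCurves.ModularForms Literature.NumberTheory.EllipticCurves.Rank1Residual
  Literature.NumberTheory.EllipticCurves.Rank1Residual.Typed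
  Literature.NumberTheory.EllipticCurves.Rank1Residual.X11RankOneCertificates
  Summit.BirchSwinnertonDyer.BirchSwinnertonDyer.Rank1Residual.IntModel
  Summit.BirchSwinnertonDyer.BirchSwinnertonDyer.Rank1Residual.X11RankOne
  Summit.BirchSwinnertonDyer.Rank1Residual.X11b

namespace Summit.BirchSwinnertonDyer.Rank1Residual.X9
/-! ### §1. Frobenius point counts (kernel-decided data) -/

/-- `#Ẽ(𝔽₅) = 4` (`a₅ = 2`: good ORDINARY) for Cremona's model `69312bg1` (kernel count). [folklore] -/
theorem card_t69312bg1_5 :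
    Nat.card (((⟨0, 1, 0, -64017, -13999473⟩ : WeierstrassCurve ℤ).map
      (Int.castRingHom (ZMod 5))).toAffine.Point) = 4 := by
  rw [@WeierstrassCurve.natCard_point_eq_one_add_card (ZMod 5) (@ZMod.instField 5 ⟨by norm_num⟩) _ _ _
    (by decide +kernel), @card_sol_eq_sum_euler (ZMod 5) (@ZMod.instField 5 ⟨by norm_num⟩) _ _
    (by rw [ZMod.ringChar_zmod_n]; decide), ZMod.card]
  decide +kernel

/-- `#Ẽ(𝔽₇) = 13` (`a₇ = -5`; `X² − a₇X + 7` root-free mod `5`) for Cremona's model `69312bg1` (kernel count). [folklore] -/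
theorem card_t69312bg1_7 :
    Nat.card (((⟨0, 1, 0, -64017, -13999473⟩ : WeierstrassCurve ℤ).map
      (Int.castRingHom (ZMod 7))).toAffine.Point) = 13 := by
  rw [@WeierstrassCurve.natCard_point_eq_one_add_card (ZMod 7) (@ZMod.instField 7 ⟨by norm_num⟩) _ _ _
    (by decide +kernel), @card_sol_eq_sum_euler (ZMod 7) (@ZMod.instField 7 ⟨by norm_num⟩) _ _
    (by rw [ZMod.ringChar_zmod_n]; decide), ZMod.card]
  decide +kernel

/-- `#Ã(𝔽₅) = 9` (`a₅ = -3`: good ORDINARY) for Cremona's model `23104d1` (kernel count). [folklore] -/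
theorem card_s23104d1_5 :
    Nat.card (((⟨0, -1, 0, -612737, 184816009⟩ : WeierstrassCurve ℤ).map
      (Int.castRingHom (ZMod 5))).toAffine.Point) = 9 := by
  rw [@WeierstrassCurve.natCard_point_eq_one_add_card (ZMod 5) (@ZMod.instField 5 ⟨by norm_num⟩) _ _ _
    (by decide +kernel), @card_sol_eq_sum_euler (ZMod 5) (@ZMod.instField 5 ⟨by norm_num⟩) _ _
    (by rw [ZMod.ringChar_zmod_n]; decide), ZMod.card]
  decide +kernel

/-- `#Ẽ(𝔽₅) = 4` (`a₅ = 2`: good ORDINARY) for Cremona's model `69312dm1` (kernel count). [folklore] -/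
theorem card_t69312dm1_5 :
    Nat.card (((⟨0, 1, 0, -177, -2097⟩ : WeierstrassCurve ℤ).map
      (Int.castRingHom (ZMod 5))).toAffine.Point) = 4 := by
  rw [@WeierstrassCurve.natCard_point_eq_one_add_card (ZMod 5) (@ZMod.instField 5 ⟨by norm_num⟩) _ _ _
    (by decide +kernel), @card_sol_eq_sum_euler (ZMod 5) (@ZMod.instField 5 ⟨by norm_num⟩) _ _
    (by rw [ZMod.ringChar_zmod_n]; decide), ZMod.card]
  decide +kernel

/-- `#Ẽ(𝔽₇) = 3` (`a₇ = 5`; `X² − a₇X + 7` root-free mod `5`) for Cremona's model `69312dm1` (kernel count). [folklore] -/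
theorem card_t69312dm1_7 :
    Nat.card (((⟨0, 1, 0, -177, -2097⟩ : WeierstrassCurve ℤ).map
      (Int.castRingHom (ZMod 7))).toAffine.Point) = 3 := by
  rw [@WeierstrassCurve.natCard_point_eq_one_add_card (ZMod 7) (@ZMod.instField 7 ⟨by norm_num⟩) _ _ _
    (by decide +kernel), @card_sol_eq_sum_euler (ZMod 7) (@ZMod.instField 7 ⟨by norm_num⟩) _ _
    (by rw [ZMod.ringChar_zmod_n]; decide), ZMod.card]
  decide +kernel

/-- `#Ã(𝔽₅) = 9` (`a₅ = -3`: good ORDINARY) for Cremona's model `23104bw1` (kernel count). [folklore] -/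
theorem card_s23104bw1_5 :
    Nat.card (((⟨0, -1, 0, -1697, 27481⟩ : WeierstrassCurve ℤ).map
      (Int.castRingHom (ZMod 5))).toAffine.Point) = 9 := by
  rw [@WeierstrassCurve.natCard_point_eq_one_add_card (ZMod 5) (@ZMod.instField 5 ⟨by norm_num⟩) _ _ _
    (by decide +kernel), @card_sol_eq_sum_euler (ZMod 5) (@ZMod.instField 5 ⟨by norm_num⟩) _ _
    (by rw [ZMod.ringChar_zmod_n]; decide), ZMod.card]
  decide +kernel

/-- `#Ẽ(𝔽₅) = 3` (`a₅ = 3`: good ORDINARY) for Cremona's model `88872n1` (kernel count). [folklore] -/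
theorem card_t88872n1_5 :
    Nat.card (((⟨0, 1, 0, -1030139, -387778062⟩ : WeierstrassCurve ℤ).map
      (Int.castRingHom (ZMod 5))).toAffine.Point) = 3 := by
  rw [@WeierstrassCurve.natCard_point_eq_one_add_card (ZMod 5) (@ZMod.instField 5 ⟨by norm_num⟩) _ _ _
    (by decide +kernel), @card_sol_eq_sum_euler (ZMod 5) (@ZMod.instField 5 ⟨by norm_num⟩) _ _
    (by rw [ZMod.ringChar_zmod_n]; decide), ZMod.card]
  decide +kernel

/-- `#Ẽ(𝔽₁₁) = 8` (`a₁₁ = 4`; `X² − a₁₁X + 11` root-free mod `5`) for Cremona's model `88872n1` (kernel count). [folklore] -/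
theorem card_t88872n1_11 :
    Nat.card (((⟨0, 1, 0, -1030139, -387778062⟩ : WeierstrassCurve ℤ).map
      (Int.castRingHom (ZMod 11))).toAffine.Point) = 8 := by
  rw [@WeierstrassCurve.natCard_point_eq_one_add_card (ZMod 11) (@ZMod.instField 11 ⟨by norm_num⟩) _ _ _
    (by decide +kernel), @card_sol_eq_sum_euler (ZMod 11) (@ZMod.instField 11 ⟨by norm_num⟩) _ _
    (by rw [ZMod.ringChar_zmod_n]; decide), ZMod.card]
  decide +kernel

/-- `#Ã(𝔽₅) = 8` (`a₅ = -2`: good ORDINARY) for Cremona's model `4232d1` (kernel count). [folklore] -/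
theorem card_s4232d1_5 :
    Nat.card (((⟨0, -1, 0, 4056, 599788⟩ : WeierstrassCurve ℤ).map
      (Int.castRingHom (ZMod 5))).toAffine.Point) = 8 := by
  rw [@WeierstrassCurve.natCard_point_eq_one_add_card (ZMod 5) (@ZMod.instField 5 ⟨by norm_num⟩) _ _ _
    (by decide +kernel), @card_sol_eq_sum_euler (ZMod 5) (@ZMod.instField 5 ⟨by norm_num⟩) _ _
    (by rw [ZMod.ringChar_zmod_n]; decide), ZMod.card]
  decide +kernel

/-! ### §2. Ellipticity and global minimality of the literal models (kernel) -/

/-- `69312bg1`'s Cremona model is an elliptic curve (`Δ ≠ 0`, kernel). [cite: Cremona2006, Table 1 (Cremona label 69312bg1)] -/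
theorem isElliptic_t69312bg1 : (⟨0, 1, 0, -64017, -13999473⟩ : WeierstrassCurve ℚ).IsElliptic :=
  isElliptic_of_discOf_ne_zero 0 1 0 (-64017) (-13999473) (by decide +kernel)

/-- `69312bg1`'s Cremona model is globally minimal (Kraus' bounded criterion, kernel). [cite: SilvermanAEC2009, VII.1 Remark 1.1] -/
theorem isGloballyMinimal_t69312bg1 : (⟨0, 1, 0, -64017, -13999473⟩ : WeierstrassCurve ℚ).IsGloballyMinimal :=
  isGloballyMinimal_of_krausCriterion_bounded₂ 0 1 0 (-64017) (-13999473) (by decide +kernel) (by decide +kernel)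
    (by decide +kernel)

/-- `23104d1`'s Cremona model is an elliptic curve (`Δ ≠ 0`, kernel). [cite: Cremona2006, Table 1 (Cremona label 23104d1)] -/
theorem isElliptic_s23104d1 : (⟨0, -1, 0, -612737, 184816009⟩ : WeierstrassCurve ℚ).IsElliptic :=
  isElliptic_of_discOf_ne_zero 0 (-1) 0 (-612737) 184816009 (by decide +kernel)

/-- `23104d1`'s Cremona model is globally minimal (Kraus' bounded criterion, kernel). [cite: SilvermanAEC2009, VII.1 Remark 1.1] -/
theorem isGloballyMinimal_s23104d1 : (⟨0, -1, 0, -612737, 184816009⟩ : WeierstrassCurve ℚ).IsGloballyMinimal :=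
  isGloballyMinimal_of_krausCriterion_bounded₂ 0 (-1) 0 (-612737) 184816009 (by decide +kernel) (by decide +kernel)
    (by decide +kernel)

/-- `69312dm1`'s Cremona model is an elliptic curve (`Δ ≠ 0`, kernel). [cite: Cremona2006, Table 1 (Cremona label 69312dm1)] -/
theorem isElliptic_t69312dm1 : (⟨0, 1, 0, -177, -2097⟩ : WeierstrassCurve ℚ).IsElliptic :=
  isElliptic_of_discOf_ne_zero 0 1 0 (-177) (-2097) (by decide +kernel)

/-- `69312dm1`'s Cremona model is globally minimal (Kraus' bounded criterion, kernel). [cite: SilvermanAEC2009, VII.1 Remark 1.1] -/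
theorem isGloballyMinimal_t69312dm1 : (⟨0, 1, 0, -177, -2097⟩ : WeierstrassCurve ℚ).IsGloballyMinimal :=
  isGloballyMinimal_of_krausCriterion_bounded₂ 0 1 0 (-177) (-2097) (by decide +kernel) (by decide +kernel)
    (by decide +kernel)

/-- `23104bw1`'s Cremona model is an elliptic curve (`Δ ≠ 0`, kernel). [cite: Cremona2006, Table 1 (Cremona label 23104bw1)] -/
theorem isElliptic_s23104bw1 : (⟨0, -1, 0, -1697, 27481⟩ : WeierstrassCurve ℚ).IsElliptic :=
  isElliptic_of_discOf_ne_zero 0 (-1) 0 (-1697) 27481 (by decide +kernel)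

/-- `23104bw1`'s Cremona model is globally minimal (Kraus' bounded criterion, kernel). [cite: SilvermanAEC2009, VII.1 Remark 1.1] -/
theorem isGloballyMinimal_s23104bw1 : (⟨0, -1, 0, -1697, 27481⟩ : WeierstrassCurve ℚ).IsGloballyMinimal :=
  isGloballyMinimal_of_krausCriterion_bounded₂ 0 (-1) 0 (-1697) 27481 (by decide +kernel) (by decide +kernel)
    (by decide +kernel)

/-- `88872n1`'s Cremona model is an elliptic curve (`Δ ≠ 0`, kernel). [cite: Cremona2006, Table 1 (Cremona label 88872n1)] -/
theorem isElliptic_t88872n1 : (⟨0, 1, 0, -1030139, -387778062⟩ : WeierstrassCurve ℚ).IsElliptic :=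
  isElliptic_of_discOf_ne_zero 0 1 0 (-1030139) (-387778062) (by decide +kernel)

/-- `88872n1`'s Cremona model is globally minimal (Kraus' bounded criterion, kernel). [cite: SilvermanAEC2009, VII.1 Remark 1.1] -/
theorem isGloballyMinimal_t88872n1 : (⟨0, 1, 0, -1030139, -387778062⟩ : WeierstrassCurve ℚ).IsGloballyMinimal :=
  isGloballyMinimal_of_krausCriterion_bounded₂ 0 1 0 (-1030139) (-387778062) (by decide +kernel) (by decide +kernel)
    (by decide +kernel)

/-- `4232d1`'s Cremona model is an elliptic curve (`Δ ≠ 0`, kernel). [cite: Cremona2006, Table 1 (Cremona label 4232d1)] -/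
theorem isElliptic_s4232d1 : (⟨0, -1, 0, 4056, 599788⟩ : WeierstrassCurve ℚ).IsElliptic :=
  isElliptic_of_discOf_ne_zero 0 (-1) 0 4056 599788 (by decide +kernel)

/-- `4232d1`'s Cremona model is globally minimal (Kraus' bounded criterion, kernel). [cite: SilvermanAEC2009, VII.1 Remark 1.1] -/
theorem isGloballyMinimal_s4232d1 : (⟨0, -1, 0, 4056, 599788⟩ : WeierstrassCurve ℚ).IsGloballyMinimal :=
  isGloballyMinimal_of_krausCriterion_bounded₂ 0 (-1) 0 4056 599788 (by decide +kernel) (by decide +kernel)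
    (by decide +kernel)

/-! ### §3. The records -/

/-- **`BSD(E,5)` for `69312bg1`** (`N = 69312 = 2⁶·3·19²`; good ORDINARY at `5`, `a₅ = 2`; Cremona model `[0, 1, 0,
-64017, -13999473]`; `ρ̄_{E,5}` irreducible (Frobenius witness `ℓ = 7`: `#Ẽ(𝔽₇) = 13`, `a₇ = -5`) and — census datum —
of EXCEPTIONAL type `5S4`; analytic rank `0`; `#Ш_an = 1`; `∏c_ℓ = 10` (`ord₅ ∏c_ℓ ≥ 1`: Tamagawa-obstructed Heegner
index); route of record: the Jetchev–Cha index bound ONLY (x9 fold `JETCHEV-CHA`: `D = -143`, `m = 20`, `ord₅ m = 1` =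
the Tamagawa valuation; flag `Miller11-Thm54-Cha-case` / lane `JET@nonsurj`; its `5`-descent line is [GRH] only)) —
**from the mod-`5` CONGRUENT LEVEL-LOWERED partner `23104d1`** (`N_A = 23104 = 2⁶·19²` divides `N_E`: `E[5]` is
unramified at the extra multiplicative prime `ℓ = 3` of `E`, where `5 ∣ c_ℓ = v_ℓ(Δ)`; `5S4`, `a₅(A) = -3`, `r_an(A) =
1`, `#Ш_an(A) = 1`, `∏c_ℓ(A) = 1`; Heegner route of record CERT `D = -31`, `m = 8`, `ord₅ m = 0`, two engines (x9
fold), unflagged) by Greenberg–Vatsal transport (`bsdp_of_ainvs_of_bsdpPartner_of_congruences_of_analyticRank_le_one`: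
`BSDp A 5` (`hbsdA`, the binder the partner's certificate discharges)) + C2 + C3 ⟹ Mazur's main conjecture for `(A,5)`
with `μ = 0` ⟹ the same for `(E,5)` along `A[5] ≅ E[5]` ⟹ `BSD(E,5)`. Kernel-decided: `Δ ≠ 0` and minimality of both
models (`isElliptic_*`, `isGloballyMinimal_*` discharge the instance binders), `#Ẽ(𝔽₅) = 4`, `#Ã(𝔽₅) = 9`, `E[5]`
irreducible. Certificates (unit `b2b-bsdres-x9` gen 16, kit j130867; `HOME/b2b-bsdres-x9/g16/sweep/`): C1 = `hcong`
with `M = 69 312` (`S = ∅`), `μ(M) = 145 920`, bound `B = 24 319`: all `2 699` primes `ℓ ≤ B` with `v_ℓ(N_E N_A) ≤ 1`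
checked, `0` exceptions, TWO engines (PARI `ellap` via cypari2; ENGINE D pure-Python BSGS/Mestre, identical count, `0`
fallbacks); C2 = `hcertA` (`μ(𝓛₅(A)) = 0`: gen 9 `MU-ALL.tsv`, engines B and C, `λ = 1`; the certified unit
coefficient is not the constant term); C3 for the partner = `hSchA` (PARI `ellpadicheight` `[v(f),v(g)] = [1,2]`,
`v₅(s₂) = 0`, `v₅(f − s₂g) = 1` + Mazur–Tate σ engine `v₅(h) = 0` (kit j130867); both finite ⇒ the cyclotomic `5`-adic
height of `A`'s Cremona generator is non-zero); `hC3` vacuous (`r_an(E) = 0`). Binders otherwise PUBLISHED (`hKO` …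
`hGZK`); FINITE `r_an(E) ≤ 1`, `r_an(A) ≤ 1`. Per pair; nothing booked; no Jetchev, no descent of the target, no GRH.
[cite: GreenbergVatsal2000, Thm. (1.4) (arXiv p. 5)] [cite: KrausOesterle1992, Prop. 4] [cite: Miller2011LMS, Def. 1.1]
[cite: Cremona2006, Table 1 (Cremona labels 69312bg1, 23104d1)] -/
theorem bsdp_t69312bg1_of_bsdp_s23104d1
    (hKO : KrausOesterle1992.prop4_torsionIso_of_congruences)
    (hBCS : burungale_castella_skinner_charIdeal_eq_padicLFunction)
    (hGr : greenberg_charValue_rankZero) (h5 : realPeriodRat_eq_unit_mul_plusPeriod)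
    (hGV : GreenbergVatsal2000.thm14_mainConjecture_transfer_of_torsionIso)
    (hS : Schneider1985_order_charGenerator) (hPR : perrinRiou_rankOne_leadingTerms)
    (hmodP : nonempty_modularParametrizationData) (hmodL : hasEntireLFunction_rat)
    (hGZK : rank_eq_analyticRank_of_analyticRank_le_one)
    (W A : WeierstrassCurve ℚ) [W.IsElliptic] [W.IsGloballyMinimal] [A.IsElliptic] [A.IsGloballyMinimal]
    [Fact (Nat.Prime 5)]
    (hW : W = ⟨0, 1, 0, -64017, -13999473⟩) (hA : A = ⟨0, -1, 0, -612737, 184816009⟩)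
    (hran : W.analyticRank ≤ 1) (hrA : A.analyticRank ≤ 1) (hbsdA : BSDp A 5)
    (hSchA : A.analyticRank = 1 → ∀ Dh : PAdicHeightData A 5, Dh.IsCanonical → SchneiderConjecture Dh)
    (hcertA : ∀ [NeZero (A.conductorNorm ℤ)] (fA : CuspForm (Gamma0 (A.conductorNorm ℤ)) 2),
        IsNewformOf A fA → ∀ (ϖ : ℚ), (ϖ : ℝ) * A.realPeriodRat = plusPeriod fA →
      ∃ n : ℕ, ‖PowerSeries.coeff n
        (PowerSeries.C (ϖ : ℚ_[5]) * padicLFunction fA (unitRoot A 5 : ℚ_[5]))‖ = 1)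
    (hcong : ∀ (ℓ : ℕ) [Fact ℓ.Prime],
      6 * ℓ < KrausOesterle1992.gammaZeroIndex (KrausOesterle1992.modulus W A) →
      (padicValNat ℓ (W.conductorNorm ℤ * A.conductorNorm ℤ) = 0 →
          (5 : ℤ) ∣ W.frobeniusTrace ℓ - A.frobeniusTrace ℓ) ∧
        (padicValNat ℓ (W.conductorNorm ℤ * A.conductorNorm ℤ) = 1 →
          (5 : ℤ) ∣ W.frobeniusTrace ℓ * A.frobeniusTrace ℓ - (ℓ + 1)))
    (hC3 : W.analyticRank = 1 → ∀ Dh : PAdicHeightData W 5, Dh.IsCanonical → SchneiderConjecture Dh) :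
    BSDp W 5 := by
  have hIW : integralModelInt W = ⟨0, 1, 0, -64017, -13999473⟩ :=
    integralModelInt_eq_of_map_eq _ (by rw [hW]; ext <;> simp [WeierstrassCurve.map])
  have hIA : integralModelInt A = ⟨0, -1, 0, -612737, 184816009⟩ :=
    integralModelInt_eq_of_map_eq _ (by rw [hA]; ext <;> simp [WeierstrassCurve.map])
  haveI : Fact (Nat.Prime 7) := ⟨by norm_num⟩
  exact bsdp_of_ainvs_of_bsdpPartner_of_congruences_of_analyticRank_le_one hKO hBCS hGr h5 hGV hS hPR hmodP hmodL hGZK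
    0 1 0 (-64017) (-13999473) hIW
    0 (-1) 0 (-612737) 184816009 hIA
    5 7 13 4 9 (by norm_num) (by decide +kernel) card_t69312bg1_5 (by decide) (by decide)
    (by decide +kernel) card_t69312bg1_7 (by decide) (by decide +kernel) card_s23104d1_5 (by decide)
    hran hrA hbsdA hSchA hcertA hcong hC3

/-- **`BSD(E,5)` for `69312dm1`** (`N = 69312 = 2⁶·3·19²`; good ORDINARY at `5`, `a₅ = 2`; Cremona model `[0, 1, 0,
-177, -2097]`; `ρ̄_{E,5}` irreducible (Frobenius witness `ℓ = 7`: `#Ẽ(𝔽₇) = 3`, `a₇ = 5`) and — census datum — of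
EXCEPTIONAL type `5S4`; analytic rank `0`; `#Ш_an = 1`; `∏c_ℓ = 10` (`ord₅ ∏c_ℓ ≥ 1`: Tamagawa-obstructed Heegner
index); route of record: the Jetchev–Cha index bound ONLY (x9 fold `JETCHEV-CHA`: `D = -71`, `m = 20`, `ord₅ m = 1` =
the Tamagawa valuation; flag `Miller11-Thm54-Cha-case` / lane `JET@nonsurj`; its `5`-descent line is [GRH] only)) —
**from the mod-`5` CONGRUENT LEVEL-LOWERED partner `23104bw1`** (`N_A = 23104 = 2⁶·19²` divides `N_E`: `E[5]` is
unramified at the extra multiplicative prime `ℓ = 3` of `E`, where `5 ∣ c_ℓ = v_ℓ(Δ)`; `5S4`, `a₅(A) = -3`, `r_an(A) =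
1`, `#Ш_an(A) = 1`, `∏c_ℓ(A) = 1`; Heegner route of record CERT `D = -31`, `m = 8`, `ord₅ m = 0`, two engines (x9
fold), unflagged) by Greenberg–Vatsal transport (`bsdp_of_ainvs_of_bsdpPartner_of_congruences_of_analyticRank_le_one`:
`BSDp A 5` (`hbsdA`, the binder the partner's certificate discharges)) + C2 + C3 ⟹ Mazur's main conjecture for `(A,5)`
with `μ = 0` ⟹ the same for `(E,5)` along `A[5] ≅ E[5]` ⟹ `BSD(E,5)`. Kernel-decided: `Δ ≠ 0` and minimality of both
models (`isElliptic_*`, `isGloballyMinimal_*` discharge the instance binders), `#Ẽ(𝔽₅) = 4`, `#Ã(𝔽₅) = 9`, `E[5]`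
irreducible. Certificates (unit `b2b-bsdres-x9` gen 16, kit j130867; `HOME/b2b-bsdres-x9/g16/sweep/`): C1 = `hcong`
with `M = 69 312` (`S = ∅`), `μ(M) = 145 920`, bound `B = 24 319`: all `2 699` primes `ℓ ≤ B` with `v_ℓ(N_E N_A) ≤ 1`
checked, `0` exceptions, TWO engines (PARI `ellap` via cypari2; ENGINE D pure-Python BSGS/Mestre, identical count, `0`
fallbacks); C2 = `hcertA` (`μ(𝓛₅(A)) = 0`: gen 9 `MU-ALL.tsv`, engines B and C, `λ = 1`; the certified unit
coefficient is not the constant term); C3 for the partner = `hSchA` (PARI `ellpadicheight` `[v(f),v(g)] = [1,2]`,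
`v₅(s₂) = 0`, `v₅(f − s₂g) = 1` + Mazur–Tate σ engine `v₅(h) = 0` (kit j130867); both finite ⇒ the cyclotomic `5`-adic
height of `A`'s Cremona generator is non-zero); `hC3` vacuous (`r_an(E) = 0`). Binders otherwise PUBLISHED (`hKO` …
`hGZK`); FINITE `r_an(E) ≤ 1`, `r_an(A) ≤ 1`. Per pair; nothing booked; no Jetchev, no descent of the target, no GRH.
[cite: GreenbergVatsal2000, Thm. (1.4) (arXiv p. 5)] [cite: KrausOesterle1992, Prop. 4] [cite: Miller2011LMS, Def. 1.1]
[cite: Cremona2006, Table 1 (Cremona labels 69312dm1, 23104bw1)] -/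
theorem bsdp_t69312dm1_of_bsdp_s23104bw1
    (hKO : KrausOesterle1992.prop4_torsionIso_of_congruences)
    (hBCS : burungale_castella_skinner_charIdeal_eq_padicLFunction)
    (hGr : greenberg_charValue_rankZero) (h5 : realPeriodRat_eq_unit_mul_plusPeriod)
    (hGV : GreenbergVatsal2000.thm14_mainConjecture_transfer_of_torsionIso)
    (hS : Schneider1985_order_charGenerator) (hPR : perrinRiou_rankOne_leadingTerms)
    (hmodP : nonempty_modularParametrizationData) (hmodL : hasEntireLFunction_rat)
    (hGZK : rank_eq_analyticRank_of_analyticRank_le_one)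
    (W A : WeierstrassCurve ℚ) [W.IsElliptic] [W.IsGloballyMinimal] [A.IsElliptic] [A.IsGloballyMinimal]
    [Fact (Nat.Prime 5)]
    (hW : W = ⟨0, 1, 0, -177, -2097⟩) (hA : A = ⟨0, -1, 0, -1697, 27481⟩)
    (hran : W.analyticRank ≤ 1) (hrA : A.analyticRank ≤ 1) (hbsdA : BSDp A 5)
    (hSchA : A.analyticRank = 1 → ∀ Dh : PAdicHeightData A 5, Dh.IsCanonical → SchneiderConjecture Dh)
    (hcertA : ∀ [NeZero (A.conductorNorm ℤ)] (fA : CuspForm (Gamma0 (A.conductorNorm ℤ)) 2),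
        IsNewformOf A fA → ∀ (ϖ : ℚ), (ϖ : ℝ) * A.realPeriodRat = plusPeriod fA →
      ∃ n : ℕ, ‖PowerSeries.coeff n
        (PowerSeries.C (ϖ : ℚ_[5]) * padicLFunction fA (unitRoot A 5 : ℚ_[5]))‖ = 1)
    (hcong : ∀ (ℓ : ℕ) [Fact ℓ.Prime],
      6 * ℓ < KrausOesterle1992.gammaZeroIndex (KrausOesterle1992.modulus W A) →
      (padicValNat ℓ (W.conductorNorm ℤ * A.conductorNorm ℤ) = 0 →
          (5 : ℤ) ∣ W.frobeniusTrace ℓ - A.frobeniusTrace ℓ) ∧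
        (padicValNat ℓ (W.conductorNorm ℤ * A.conductorNorm ℤ) = 1 →
          (5 : ℤ) ∣ W.frobeniusTrace ℓ * A.frobeniusTrace ℓ - (ℓ + 1)))
    (hC3 : W.analyticRank = 1 → ∀ Dh : PAdicHeightData W 5, Dh.IsCanonical → SchneiderConjecture Dh) :
    BSDp W 5 := by
  have hIW : integralModelInt W = ⟨0, 1, 0, -177, -2097⟩ :=
    integralModelInt_eq_of_map_eq _ (by rw [hW]; ext <;> simp [WeierstrassCurve.map])
  have hIA : integralModelInt A = ⟨0, -1, 0, -1697, 27481⟩ :=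
    integralModelInt_eq_of_map_eq _ (by rw [hA]; ext <;> simp [WeierstrassCurve.map])
  haveI : Fact (Nat.Prime 7) := ⟨by norm_num⟩
  exact bsdp_of_ainvs_of_bsdpPartner_of_congruences_of_analyticRank_le_one hKO hBCS hGr h5 hGV hS hPR hmodP hmodL hGZK
    0 1 0 (-177) (-2097) hIW
    0 (-1) 0 (-1697) 27481 hIA
    5 7 3 4 9 (by norm_num) (by decide +kernel) card_t69312dm1_5 (by decide) (by decide)
    (by decide +kernel) card_t69312dm1_7 (by decide) (by decide +kernel) card_s23104bw1_5 (by decide)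
    hran hrA hbsdA hSchA hcertA hcong hC3

/-- **`BSD(E,5)` for `88872n1`** (`N = 88872 = 2³·3·7·23²`; good ORDINARY at `5`, `a₅ = 3`; Cremona model `[0, 1, 0,
-1030139, -387778062]`; `ρ̄_{E,5}` irreducible (Frobenius witness `ℓ = 11`: `#Ẽ(𝔽₁₁) = 8`, `a₁₁ = 4`) and — census
datum — of EXCEPTIONAL type `5S4`; analytic rank `1`; `#Ш_an = 1`; `∏c_ℓ = 10` (`ord₅ ∏c_ℓ ≥ 1`: Tamagawa-obstructed
Heegner index); route of record: the Jetchev–Cha index bound ONLY (x9 fold `JETCHEV-CHA`: `D = -143`, `m = 40`, `ord₅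
m = 1` = the Tamagawa valuation; flag `Miller11-Thm54-Cha-case` / lane `JET@nonsurj`; its `5`-descent line is [GRH]
only)) — **from the mod-`5` CONGRUENT LEVEL-LOWERED partner `4232d1`** (`N_A = 4232 = 2³·23²` divides `N_E`: `E[5]` is
unramified at the extra multiplicative prime `ℓ = 21` of `E`, where `5 ∣ c_ℓ = v_ℓ(Δ)`; `5S4`, `a₅(A) = -2`, `r_an(A)
= 0`, `#Ш_an(A) = 1`, `∏c_ℓ(A) = 3`; Heegner route of record CERT `D = -7`, `m = 6`, `ord₅ m = 0`, two engines (x9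
fold), unflagged) by Greenberg–Vatsal transport
(`bsdp_of_ainvs_of_conductor_lt_of_congruences_of_analyticRank_le_one`: `N_A < 5000`, so `BSD(A,5)` is Miller 2011
Thm. 1.2 (`hMiller`, PUBLISHED; `A[5]` irreducible along the Kraus–Oesterlé isomorphism) — NO `BSDp` binder) + C2 + C3
⟹ Mazur's main conjecture for `(A,5)` with `μ = 0` ⟹ the same for `(E,5)` along `A[5] ≅ E[5]` ⟹ `BSD(E,5)`; in rank
`1` of the target the last step is the rank-one leading-term comparison (Perrin-Riou–Schneider, Perrin-Riou 1987) with
`hC3`. Kernel-decided: `Δ ≠ 0` and minimality of both models (`isElliptic_*`, `isGloballyMinimal_*` discharge the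
instance binders), `#Ẽ(𝔽₅) = 3`, `#Ã(𝔽₅) = 8`, `E[5]` irreducible. Certificates (unit `b2b-bsdres-x9` gen 16, kit
j130867; `HOME/b2b-bsdres-x9/g16/sweep/`): C1 = `hcong` with `M = 88 872` (`S = ∅`), `μ(M) = 211 968`, bound `B = 35
327`: all `3 762` primes `ℓ ≤ B` with `v_ℓ(N_E N_A) ≤ 1` checked, `0` exceptions, TWO engines (PARI `ellap` via
cypari2; ENGINE D pure-Python BSGS/Mestre, identical count, `0` fallbacks); C2 = `hcertA` (`μ(𝓛₅(A)) = 0`: gen 9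
`MU-ALL.tsv`, engines B and C, `λ = 0`); `hSchA` vacuous (`r_an(A) = 0`); C3 for the target = `hC3` (PARI
`ellpadicheight` `[v(f),v(g)] = [0,2]`, `v₅(s₂) = 0`, `v₅(f − s₂g) = 0` + Mazur–Tate σ engine `v₅(h) = -1` (kit
j130867); both finite ⇒ the cyclotomic `5`-adic height of `E`'s Cremona generator is non-zero). Binders otherwise
PUBLISHED (`hKO`, `hMiller` … `hGZK`); FINITE `r_an(E) ≤ 1`, `r_an(A) ≤ 1`, `N_A < 5000`. Per pair; nothing booked; no
Jetchev, no descent of the target, no GRH.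
[cite: GreenbergVatsal2000, Thm. (1.4) (arXiv p. 5)] [cite: KrausOesterle1992, Prop. 4] [cite: Miller2011LMS, Thm. 1.2] [cite: Miller2011LMS, Def. 1.1]
[cite: Cremona2006, Table 1 (Cremona labels 88872n1, 4232d1)] -/
theorem bsdp_t88872n1
    (hKO : KrausOesterle1992.prop4_torsionIso_of_congruences)
    (hMiller : bsdp_of_irreducible_of_conductor_lt)
    (hBCS : burungale_castella_skinner_charIdeal_eq_padicLFunction)
    (hGr : greenberg_charValue_rankZero) (h5 : realPeriodRat_eq_unit_mul_plusPeriod)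
    (hGV : GreenbergVatsal2000.thm14_mainConjecture_transfer_of_torsionIso)
    (hS : Schneider1985_order_charGenerator) (hPR : perrinRiou_rankOne_leadingTerms)
    (hmodP : nonempty_modularParametrizationData) (hmodL : hasEntireLFunction_rat)
    (hGZK : rank_eq_analyticRank_of_analyticRank_le_one)
    (W A : WeierstrassCurve ℚ) [W.IsElliptic] [W.IsGloballyMinimal] [A.IsElliptic] [A.IsGloballyMinimal]
    [Fact (Nat.Prime 5)]
    (hW : W = ⟨0, 1, 0, -1030139, -387778062⟩) (hA : A = ⟨0, -1, 0, 4056, 599788⟩)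
    (hran : W.analyticRank ≤ 1) (hrA : A.analyticRank ≤ 1) (hNA : A.conductorNorm ℤ < 5000)
    (hSchA : A.analyticRank = 1 → ∀ Dh : PAdicHeightData A 5, Dh.IsCanonical → SchneiderConjecture Dh)
    (hcertA : ∀ [NeZero (A.conductorNorm ℤ)] (fA : CuspForm (Gamma0 (A.conductorNorm ℤ)) 2),
        IsNewformOf A fA → ∀ (ϖ : ℚ), (ϖ : ℝ) * A.realPeriodRat = plusPeriod fA →
      ∃ n : ℕ, ‖PowerSeries.coeff n
        (PowerSeries.C (ϖ : ℚ_[5]) * padicLFunction fA (unitRoot A 5 : ℚ_[5]))‖ = 1)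
    (hcong : ∀ (ℓ : ℕ) [Fact ℓ.Prime],
      6 * ℓ < KrausOesterle1992.gammaZeroIndex (KrausOesterle1992.modulus W A) →
      (padicValNat ℓ (W.conductorNorm ℤ * A.conductorNorm ℤ) = 0 →
          (5 : ℤ) ∣ W.frobeniusTrace ℓ - A.frobeniusTrace ℓ) ∧
        (padicValNat ℓ (W.conductorNorm ℤ * A.conductorNorm ℤ) = 1 →
          (5 : ℤ) ∣ W.frobeniusTrace ℓ * A.frobeniusTrace ℓ - (ℓ + 1)))
    (hC3 : W.analyticRank = 1 → ∀ Dh : PAdicHeightData W 5, Dh.IsCanonical → SchneiderConjecture Dh) :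
    BSDp W 5 := by
  have hIW : integralModelInt W = ⟨0, 1, 0, -1030139, -387778062⟩ :=
    integralModelInt_eq_of_map_eq _ (by rw [hW]; ext <;> simp [WeierstrassCurve.map])
  have hIA : integralModelInt A = ⟨0, -1, 0, 4056, 599788⟩ :=
    integralModelInt_eq_of_map_eq _ (by rw [hA]; ext <;> simp [WeierstrassCurve.map])
  haveI : Fact (Nat.Prime 11) := ⟨by norm_num⟩
  exact bsdp_of_ainvs_of_conductor_lt_of_congruences_of_analyticRank_le_one hKO hMiller hBCS hGr h5 hGV hS hPR hmodP hmodL hGZK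
    0 1 0 (-1030139) (-387778062) hIW
    0 (-1) 0 4056 599788 hIA
    5 11 8 3 8 (by norm_num) (by decide +kernel) card_t88872n1_5 (by decide) (by decide)
    (by decide +kernel) card_t88872n1_11 (by decide) (by decide +kernel) card_s4232d1_5 (by decide)
    hran hrA hNA hSchA hcertA hcong hC3

end Summit.BirchSwinnertonDyer.Rank1Residual.X9

end
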